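import Summits.CriticalPhenomena.Ising3DConformalLimit.Theorems.MoebiusLimitExists.Negative.PedigreeCuts
import HarnessLib

/-!
# Mirror pedigrees II: the covering theorem (stub covering_all of line only-interaction-breaks-moebius, crux MoebiusLimitExists, item stmt-CriticalPhenomena-1344, route EnergyNotSigmaSquared) — game (M)

PHASE 1, game (M), of the covering theorem of the MIRROR-PEDIGREE toolkit. The model, cuts,
thresholds and PHASE 2 are in `Theorems/MoebiusLimitExists/Negative/PedigreeCuts.lean` (namespace
`…MoebiusLimitExistsNegative.Pedigree.Cover`, whose `Pt`, `pdot`, `prefl`, `pcut`, `dirs`,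
`HasPedigree`, `IsBlocker`, `hasPedigree_of_noBlocker`, … are the ones used here).

Game (M) (`Cover.gameM_cv`): with a level bound `A` and no blocker on the plane `p₂ = 0`, cuts in
the directions `±e₂` kill every blocker, by induction on the measure `⌊A/b₊⌋₊ + ⌊A/b₋⌋₊` (`b_±`
lower bounds of `|p₂|` over the blockers of either sign): one cut at a generic `T ∈ (x/2, x)`, `x`
the least `|p₂|` over blockers, discards that side and re-creates blockers only beyond `2x`
(`Cover.floor_half_lt_cv`). Anchor (`hasPedigree_of_noPlaneBlocker_cv`): a configuration without
blocker on the plane `p₂ = 0` has a mirror pedigree (game (M), then PHASE 2). Game (Z), step (i) and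
the assembly (`Cover.covering_cv`, `covering_all`) are in the companion file
`EnergyNotSigmaSquaredMoebiusLimitExistsPedigreeCovering.lean`. Nothing here asserts a Theses
statement; every fact is elementary real arithmetic on finite configurations of `ℝ³`.
-/

noncomputable section

namespace Summit.CriticalPhenomena.Ising3DConformalLimit.MoebiusLimitExistsOnlyInteraction

open Classical
open Summit.CriticalPhenomena.Ising3DConformalLimit.MoebiusLimitExistsNegative.Pedigree.Cover

namespace Cover

-- ported from Cruxes/MoebiusLimitExists/Disproof.lean §G.3 (refuter-cdisprove gen 4), kernel-checked there

/-! ### PHASE 1, game (M): killing all blockers with `±e₂` cuts when no blocker has `p₂ = 0` -/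

/-- (F1) for the cut `(e₂, T)`: if the image `(p₁, 2T − p₂, p₃)` of a kept point is a blocker then
so is the point, and it lies at `p₂ ≤ −x` whenever all blockers have `|p₂| ≥ x > T`. [folklore] -/
theorem blocker_of_image_e2_cv {p : Pt} {T : ℝ} (hT : 0 < T) (hk : p.2.1 < T)
    (hb : IsBlocker (p.1, 2 * T - p.2.1, p.2.2)) : IsBlocker p := by
  obtain ⟨-, h2, h3⟩ := hb
  simp only at h2 h3
  have habs : |p.2.1| < |2 * T - p.2.1| := by
    rw [abs_of_pos (by linarith : 0 < 2 * T - p.2.1)]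
    rcases le_or_gt 0 p.2.1 with h | h
    · rw [abs_of_nonneg h]; linarith
    · rw [abs_of_neg h]; linarith
  have h1 : p.1 < -|p.2.1| := by linarith
  refine ⟨?_, h1.le, h3⟩
  intro h0; rw [h0] at h1; simp at h1

/-- (F1) for the cut `(−e₂, T)`: image `(p₁, −2T − p₂, p₃)` of a kept point (`−p₂ < T`). [folklore] -/
theorem blocker_of_image_me2_cv {p : Pt} {T : ℝ} (hT : 0 < T) (hk : -p.2.1 < T)
    (hb : IsBlocker (p.1, -2 * T - p.2.1, p.2.2)) : IsBlocker p := by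
  obtain ⟨-, h2, h3⟩ := hb
  simp only at h2 h3
  have habs : |p.2.1| < |-2 * T - p.2.1| := by
    rw [abs_of_neg (by linarith : -2 * T - p.2.1 < 0)]
    rcases le_or_gt 0 p.2.1 with h | h
    · rw [abs_of_nonneg h]; linarith
    · rw [abs_of_neg h]; linarith
  have h1 : p.1 < -|p.2.1| := by linarith
  refine ⟨?_, h1.le, h3⟩
  intro h0; rw [h0] at h1; simp at h1

/-- The floor measure strictly drops under doubling: `⌊A/(2x)⌋₊ < ⌊A/x⌋₊` for `0 < x ≤ A`. [folklore] -/
theorem floor_half_lt_cv {A x : ℝ} (hx : 0 < x) (hxA : x ≤ A) : ⌊A / (2 * x)⌋₊ < ⌊A / x⌋₊ := by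
  have hr : 1 ≤ A / x := by rw [le_div_iff₀ hx]; linarith
  have hfl : (1:ℕ) ≤ ⌊A / x⌋₊ := Nat.le_floor (by exact_mod_cast hr)
  rw [Nat.floor_lt (div_nonneg (by linarith) (by linarith))]
  have h1 : A / x < ⌊A / x⌋₊ + 1 := Nat.lt_floor_add_one _
  have h2 : A / (2 * x) = (A / x) / 2 := by field_simp
  rw [h2]
  have : ((1:ℕ):ℝ) ≤ (⌊A / x⌋₊ : ℝ) := by exact_mod_cast hfl
  push_cast at this
  linarith

/-- A blocker has `|p₂| ≤ −p₁`. [folklore] -/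
theorem abs2_le_of_isBlocker_cv {p : Pt} (hb : IsBlocker p) : |p.2.1| ≤ -p.1 := by linarith [hb.2.1]

/-- **Game (M)**: with a level bound `A` and no blocker on the plane `p₂ = 0`, the configuration has a
pedigree provided every blocker-free configuration has one. Induction on the measure
`⌊A/b₊⌋₊ + ⌊A/b₋⌋₊` (`b_±` lower bounds of `|p₂|` on the blockers of either sign): one cut
`(±e₂, T)`, `T ∈ (x/2, x)` generic, `x` the least `|p₂|` over blockers, discards every blocker on
that side and creates blockers only beyond `2x`. [folklore] -/
theorem gameM_cv (A : ℝ) (final : ∀ Q : Finset Pt, (∀ q ∈ Q, ¬ IsBlocker q) → HasPedigree Q) :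
    ∀ (n : ℕ) (P : Finset Pt), (∀ p ∈ P, IsBlocker p → -p.1 ≤ A) → (∀ p ∈ P, IsBlocker p → p.2.1 ≠ 0) →
      (∃ bp bm : ℝ, 0 < bp ∧ 0 < bm ∧ (∀ p ∈ P, IsBlocker p → 0 < p.2.1 → bp ≤ p.2.1) ∧
        (∀ p ∈ P, IsBlocker p → p.2.1 < 0 → bm ≤ -p.2.1) ∧ ⌊A / bp⌋₊ + ⌊A / bm⌋₊ ≤ n) →
      HasPedigree P := by
  intro n
  induction n with
  | zero =>
    intro P hA hZ ⟨bp, bm, hbp, hbm, hBp, hBm, hμ⟩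
    apply final
    intro q hq hb
    have h0 : ⌊A / bp⌋₊ = 0 ∧ ⌊A / bm⌋₊ = 0 := by omega
    rcases lt_trichotomy q.2.1 0 with hneg | h0' | hpos
    · have h1 := hBm q hq hb hneg
      have h2 := abs2_le_of_isBlocker_cv hb; rw [abs_of_neg hneg] at h2
      have h3 := hA q hq hb
      have : A / bm < 1 := Nat.floor_eq_zero.1 h0.2
      rw [div_lt_one hbm] at this; linarith
    · exact hZ q hq hb h0'
    · have h1 := hBp q hq hb hpos
      have h2 := abs2_le_of_isBlocker_cv hb; rw [abs_of_pos hpos] at h2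
      have h3 := hA q hq hb
      have : A / bp < 1 := Nat.floor_eq_zero.1 h0.1
      rw [div_lt_one hbp] at this; linarith
  | succ n ih =>
    intro P hA hZ ⟨bp, bm, hbp, hbm, hBp, hBm, hμ⟩
    by_cases hB : (P.filter IsBlocker).Nonempty
    swap
    · apply final; intro q hq hb; exact hB ⟨q, Finset.mem_filter.2 ⟨hq, hb⟩⟩
    obtain ⟨m, hm, hmin⟩ := (P.filter IsBlocker).exists_min_image (fun p => |p.2.1|) hB
    obtain ⟨hmP, hmb⟩ := Finset.mem_filter.1 hm
    have hmin' : ∀ p ∈ P, IsBlocker p → |m.2.1| ≤ |p.2.1| := fun p hp hb => hmin p (Finset.mem_filter.2 ⟨hp, hb⟩)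
    set x := |m.2.1| with hx
    have hx0 : 0 < x := abs_pos.2 (hZ m hmP hmb)
    have hxA : x ≤ A := le_trans (abs2_le_of_isBlocker_cv hmb) (hA m hmP hmb)
    -- generic threshold in (x/2, x)
    obtain ⟨T, hT1, hT2, hTS⟩ := exists_Ioo_not_mem (x / 2) x (by linarith)
      ((P.image fun p => p.2.1) ∪ (P.image fun p => p.2.1 / 2) ∪ (P.image fun p => -p.2.1) ∪ (P.image fun p => -p.2.1 / 2))
    have hT0 : 0 < T := by linarith
    simp only [Finset.mem_union, Finset.mem_image, not_or, not_exists, not_and] at hTS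
    obtain ⟨⟨⟨hS1, hS2⟩, hS3⟩, hS4⟩ := hTS
    rcases lt_or_gt_of_ne (hZ m hmP hmb) with hmneg | hmpos
    · -- the least blocker is on the NEGATIVE side: cut (−e₂, T)
      have hxm : x = -m.2.1 := by rw [hx, abs_of_neg hmneg]
      refine HasPedigree.cut (0,-1,0) T (by simp [dirs]) hT0 (fun p hp h => hS3 p hp (by simpa using h)) ?_
      apply ih
      · -- level bound preserved
        intro q hq hb
        rcases mem_pcut hq with ⟨hqP, -⟩ | ⟨p, hp, hpc, rfl⟩
        · exact hA q hqP hb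
        · simp only [prefl_0m10] at hb ⊢
          simp only [pdot_0m10] at hpc
          exact hA p hp (blocker_of_image_me2_cv hT0 hpc hb)
      · -- no blocker on the plane p₂ = 0
        intro q hq hb
        rcases mem_pcut hq with ⟨hqP, -⟩ | ⟨p, hp, hpc, rfl⟩
        · exact hZ q hqP hb
        · simp only [prefl_0m10] at hb ⊢
          intro h0; exact hS4 p hp (by linarith)
      · refine ⟨bp, 2 * x, hbp, by linarith, ?_, ?_, ?_⟩
        · -- positive blockers unchanged
          intro q hq hb hpos
          rcases mem_pcut hq with ⟨hqP, -⟩ | ⟨p, hp, hpc, rfl⟩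
          · exact hBp q hqP hb hpos
          · exfalso
            simp only [prefl_0m10] at hb hpos
            simp only [pdot_0m10] at hpc
            linarith
        · -- negative blockers are new images beyond 2x
          intro q hq hb hneg
          rcases mem_pcut hq with ⟨hqP, hqc⟩ | ⟨p, hp, hpc, rfl⟩
          · exfalso
            simp only [pdot_0m10] at hqc
            have := hmin' q hqP hb
            rw [abs_of_neg hneg] at this
            linarith
          · simp only [prefl_0m10] at hb hneg ⊢
            simp only [pdot_0m10] at hpc
            have hpb := blocker_of_image_me2_cv hT0 hpc hb
            have := hmin' p hp hpb
            -- p is a kept blocker: |p₂| ≥ x > T > -p₂, so p₂ > 0 and p₂ ≥ x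
            have hp2 : x ≤ p.2.1 := by
              rcases le_or_gt p.2.1 0 with h | h
              · rw [abs_of_nonpos h] at this; linarith
              · rwa [abs_of_pos h] at this
            show 2 * x ≤ -(-2 * T - p.2.1)
            linarith
        · have := floor_half_lt_cv hx0 hxA
          have hle : ⌊A / x⌋₊ ≤ ⌊A / bm⌋₊ := by
            apply Nat.floor_le_floor
            have hbmx : bm ≤ x := by rw [hxm]; exact hBm m hmP hmb hmneg
            exact div_le_div_of_nonneg_left (by linarith) hbm hbmx
          omega
    · -- the least blocker is on the POSITIVE side: cut (e₂, T)
      have hxm : x = m.2.1 := by rw [hx, abs_of_pos hmpos]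
      refine HasPedigree.cut (0,1,0) T (by simp [dirs]) hT0 (fun p hp h => hS1 p hp (by simpa using h)) ?_
      apply ih
      · intro q hq hb
        rcases mem_pcut hq with ⟨hqP, -⟩ | ⟨p, hp, hpc, rfl⟩
        · exact hA q hqP hb
        · simp only [prefl_010] at hb ⊢
          simp only [pdot_010] at hpc
          exact hA p hp (blocker_of_image_e2_cv hT0 hpc hb)
      · intro q hq hb
        rcases mem_pcut hq with ⟨hqP, -⟩ | ⟨p, hp, hpc, rfl⟩
        · exact hZ q hqP hb
        · simp only [prefl_010] at hb ⊢
          intro h0; exact hS2 p hp (by linarith)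
      · refine ⟨2 * x, bm, by linarith, hbm, ?_, ?_, ?_⟩
        · intro q hq hb hpos
          rcases mem_pcut hq with ⟨hqP, hqc⟩ | ⟨p, hp, hpc, rfl⟩
          · exfalso
            simp only [pdot_010] at hqc
            have := hmin' q hqP hb
            rw [abs_of_pos hpos] at this
            linarith
          · simp only [prefl_010] at hb hpos ⊢
            simp only [pdot_010] at hpc
            have hpb := blocker_of_image_e2_cv hT0 hpc hb
            have := hmin' p hp hpb
            have hp2 : p.2.1 ≤ -x := by
              rcases le_or_gt 0 p.2.1 with h | h
              · rw [abs_of_nonneg h] at this; linarith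
              · rw [abs_of_neg h] at this; linarith
            show 2 * x ≤ 2 * T - p.2.1
            linarith
        · intro q hq hb hneg
          rcases mem_pcut hq with ⟨hqP, -⟩ | ⟨p, hp, hpc, rfl⟩
          · exact hBm q hqP hb hneg
          · exfalso
            simp only [prefl_010] at hb hneg
            simp only [pdot_010] at hpc
            linarith
        · have := floor_half_lt_cv hx0 hxA
          have hle : ⌊A / x⌋₊ ≤ ⌊A / bp⌋₊ := by
            apply Nat.floor_le_floor
            have hbpx : bp ≤ x := by rw [hxm]; exact hBp m hmP hmb hmpos
            exact div_le_div_of_nonneg_left (by linarith) hbp hbpx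
          omega

end Cover

/-- **Games done** (anchor of this helper file): a finite configuration of `ℝ³` without BLOCKER on
the plane `p₂ = 0` has a mirror pedigree — a level bound `A` exists by finiteness, game (M)
(`Cover.gameM_cv`) kills every blocker, and PHASE 2 (`hasPedigree_of_noBlocker`) ends. [folklore] -/
theorem hasPedigree_of_noPlaneBlocker_cv :
    ∀ P : Finset (ℝ × ℝ × ℝ),
      (∀ p ∈ P, Summit.CriticalPhenomena.Ising3DConformalLimit.MoebiusLimitExistsNegative.Pedigree.Cover.IsBlocker p → p.2.1 ≠ 0) →
        Summit.CriticalPhenomena.Ising3DConformalLimit.MoebiusLimitExistsNegative.Pedigree.Cover.HasPedigree P := by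
  intro Q hZQ
  obtain ⟨A, hA⟩ := (Q.image fun p : Pt => -p.1).bddAbove
  have hAQ : ∀ p ∈ Q, IsBlocker p → -p.1 ≤ A := fun p hp _ => hA (Finset.mem_image.2 ⟨p, hp, rfl⟩)
  obtain ⟨bp, hbp, hBp⟩ := exists_pos_le_all Q fun q => q.2.1
  obtain ⟨bm, hbm, hBm⟩ := exists_pos_le_all Q fun q => -q.2.1
  exact Cover.gameM_cv A (fun Q h => hasPedigree_of_noBlocker h) _ Q hAQ hZQ
    ⟨bp, bm, hbp, hbm, fun q hq _ h => hBp q hq h, fun q hq _ h => hBm q hq (by linarith), le_rfl⟩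

end Summit.CriticalPhenomena.Ising3DConformalLimit.MoebiusLimitExistsOnlyInteraction

end
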